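import Summits.CriticalPhenomena.PercolationContinuityZ3.Theorems.PercNearOneGluingNoHeavyLowerTailSahiTwoLevelKappa

/-!
# The two-level TOP form on the faces with idle slots: exact identities, and `SahiTwoLevelPlus` there from Kahn's `C_3`

Support file of the one-cut programme (crux `NoHeavyLowerTail`, stmt-CriticalPhenomena-4575; cell `prim-bnk`, seat bnk-2 gen 10,
memo `run/shared/lean/prim/prim-l12/FROM-prim-bnk-2-g10-IDLE-FACE.md`; INEQ-CLAIMS rows COMB-M-E3 / S2-GRAPH / PLUS′).

Recall (`…SahiTwoLevelC3`, `…SahiTwoLevelKappa`): for a nested pair `H_i ⊆ G_i` (`i = 0,1,2`) of triples of increasing events of a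
product measure `μ`, the TOP two-level form is `T⁺(G,H) := twoLevelForm μ G H − ∏_i (μ(G_i) − μ(H_i))`; `SahiTwoLevelPlus` (`T⁺ ≥ 0`
for all nested pairs) is the measure-level shadow of the comb law `c_3 ≤ c_2` (COMB-M⁺) and implies Kahn's Conjecture 5
(`kahnConjecture_of_sahiTwoLevelPlus`); conversely `T⁺(G,G) = 2E_3(G)`, so the diagonal of `SahiTwoLevelPlus` IS Kahn's conjecture.
This file settles `T⁺ ≥ 0` GIVEN `C_3` (same cube) on the faces where one or two slots are IDLE (`H_i = G_i`), by exact identities: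

* `twoLevelTop_eq_of_idle₁₂` — **one moving slot** (`H_1 = G_1`, `H_2 = G_2`): `T⁺ = E_3(G_0,G_1,G_2) + E_3(H_0,G_1,G_2)` (ring identity,
  the measure-level form of prim-ineq-gen-4's "two-cylinder face" `c_2 − 2c_3 = c(β)`); hence `T⁺ ≥ 0` there from `C_3` for two triples
  (`twoLevelTop_nonneg_of_idle₁₂`).
* `twoLevelTop_eq_of_outside₀` — **slot `0` free, removed parts of slots `1,2` outside `G_0`** (`G_0 ∩ G_i ⊆ H_i`):
  `T⁺ = E_3(G_0,G_1,G_2) + E_3(H_0,G_1,G_2) + δ_1·Cov(G_0,G_2) + δ_2·Cov(G_0,G_1) + μ(G_0)(μ(G_1G_2) − μ(H_1H_2))` ⇒ `T⁺ ≥ E_3 + E_3`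
  (`sahiE3_add_sahiE3_le_twoLevelTop_of_outside₀`), `SahiTwoLevelPlus` there from `C_3` for two triples; contains both faces below.
* `twoLevelTop_eq_of_idle₀` — **one idle slot** (`F := H_0 = G_0`; `D_i := G_i ∖ H_i`, `δ_i = μ(D_i)`):
  `T⁺ = E_3(F,G_1,G_2) + E_3(F,H_1,H_2) + δ_2·μ(F ∩ D_1) + δ_1·μ(F ∩ D_2) − μ(F)·δ_1δ_2` (ring identity in the moments), and the
  bilinear form `twoLevelTop_eq_of_idle₀'`: `T⁺ = E_3(F,H_1,G_2) + E_3(F,G_1,H_2) + 2μ(F ∩ D_1 ∩ D_2) − μ(F)μ(D_1 ∩ D_2)` (the two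
  intersections written by inclusion–exclusion; = prim-ineq-gen-4 g13 (F) `c_2 − c_3 = c(F,P′,Q) + c(F,P,Q′) + 2M(F∩G) − P(F,G)` at
  measure level).  The only negative term is `μ(F)·μ(D_1 ∩ D_2 ∖ F)`; the only positive terms that are not `C_3` instances live INSIDE `F`.
* **THE OUTSIDE-REMOVAL SUB-FACE** (`G_i ∩ F ⊆ H_i`, i.e. the removed parts `D_1, D_2` lie outside `F`): `twoLevelTop_eq_of_idle₀_outside`
  `T⁺ = 2E_3(F,G_1,G_2) + δ_2·Cov(F,G_1) + δ_1·Cov(F,G_2) + μ(F)·(μ(G_1G_2) − μ(H_1H_2))`,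
  hence **`T⁺ ≥ 2·E_3(F,G_1,G_2)`** by Harris and monotonicity (`two_mul_sahiE3_le_twoLevelTop_of_idle₀_outside`; the factor is the
  measure-level shadow of the coefficientwise law `c_2 ≥ 3c_3` on this sub-face, census-sharp — memo §2), and `T⁺ ≥ 0` there from `C_3` for ONE
  triple (`twoLevelTop_nonneg_of_idle₀_outside`).
* **THE INSIDE-MEETING SUB-FACE** (`D_1 ∩ D_2 ⊆ F`): `T⁺ ≥ E_3(F,H_1,G_2) + E_3(F,G_1,H_2)` (`sahiE3_add_sahiE3_le_twoLevelTop_of_idle₀_inside`),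
  hence `T⁺ ≥ 0` from `C_3` for two triples (`twoLevelTop_nonneg_of_idle₀_inside`).
So on the idle-slot face the two-level law is reduced to Kahn's conjecture EXCEPT in the mixed regime (a removed point inside `F` in one
slot together with doubly-removed mass outside `F`), which is where the `(C¼)`-extremal `(0,3,7,4)` comb lines of the `m = 5` census live
(prim-ineq-gen-4 FINDING-EMPTY-BOTTOM-FACE-g13 / ttrl topform).  HONEST LABEL: faces of `SahiTwoLevelPlus` conditional on `C_3`; nothing
here asserts `SahiTwoLevelPlus` or `C_3`. [this work]
-/

noncomputable section

open scoped Classical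

namespace Summit.CriticalPhenomena.PercolationContinuityZ3.Theorems

open Finset Function MeasureTheory
open Literature.Combinatorics.Sahi2008
open Literature.Probability.LatticeModels (prodBernoulli prodBernoulli_harris sahiE3 sahiE3_def)
open Literature.Probability.Percolation.DecisionTree (ind ind_of_mem ind_of_not_mem ind_nonneg)

namespace SahiTwoLevelIdle

variable {κ : Type} [Fintype κ]

/-! ### One moving slot -/

omit [Fintype κ] in
/-- **One moving slot**: if `H_1 = G_1` and `H_2 = G_2` then `T⁺(G,H) = E_3(G_0,G_1,G_2) + E_3(H_0,G_1,G_2)` (ring identity in the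
moments; no hypothesis on the events). [this work] -/
theorem twoLevelTop_eq_of_idle₁₂ (q : κ → unitInterval) (G H : Fin 3 → Set (Set κ)) (h1 : H 1 = G 1) (h2 : H 2 = G 2) :
    twoLevelForm (fun A => (prodBernoulli q).real A) G H
        - ∏ i, ((prodBernoulli q).real (G i) - (prodBernoulli q).real (H i)) =
      sahiE3 (prodBernoulli q) (G 0) (G 1) (G 2) + sahiE3 (prodBernoulli q) (H 0) (G 1) (G 2) := by
  simp only [twoLevelForm, Fin.prod_univ_three, sahiE3_def, h1, h2]
  ring

omit [Fintype κ] in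
/-- **`SahiTwoLevelPlus` on the one-moving-slot face from `C_3`** for the two triples `(G_0,G_1,G_2)`, `(H_0,G_1,G_2)`. [this work] -/
theorem twoLevelTop_nonneg_of_idle₁₂ (q : κ → unitInterval) (G H : Fin 3 → Set (Set κ)) (h1 : H 1 = G 1) (h2 : H 2 = G 2)
    (hE₃G : 0 ≤ sahiE3 (prodBernoulli q) (G 0) (G 1) (G 2)) (hE₃H : 0 ≤ sahiE3 (prodBernoulli q) (H 0) (G 1) (G 2)) :
    0 ≤ twoLevelForm (fun A => (prodBernoulli q).real A) G H
        - ∏ i, ((prodBernoulli q).real (G i) - (prodBernoulli q).real (H i)) := by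
  rw [twoLevelTop_eq_of_idle₁₂ q G H h1 h2]
  exact add_nonneg hE₃G hE₃H

/-- The same from Kahn's Conjecture 5 (all three top events and `H_0` increasing). [this work] -/
theorem twoLevelTop_nonneg_of_idle₁₂_of_kahn (hK : KahnConjecture) (q : κ → unitInterval) (G H : Fin 3 → Set (Set κ))
    (h1 : H 1 = G 1) (h2 : H 2 = G 2) (hG : ∀ i, IsUpperSet (G i)) (hH0 : IsUpperSet (H 0)) :
    0 ≤ twoLevelForm (fun A => (prodBernoulli q).real A) G H
        - ∏ i, ((prodBernoulli q).real (G i) - (prodBernoulli q).real (H i)) :=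
  twoLevelTop_nonneg_of_idle₁₂ q G H h1 h2 (hK κ q _ _ _ (hG 0) (hG 1) (hG 2)) (hK κ q _ _ _ hH0 (hG 1) (hG 2))

/-! ### Removals outside the top event of slot `0` (slot `0` free) -/

omit [Fintype κ] in
/-- **Outside-`G_0` removals in slots `1, 2`, slot `0` free**: if `H_i ⊆ G_i` (`i = 0,1,2`) and `G_0 ∩ G_i ⊆ H_i` (`i = 1,2`; the removed
parts `D_1, D_2` avoid the TOP event of slot `0`) then
`T⁺ = E_3(G_0,G_1,G_2) + E_3(H_0,G_1,G_2) + δ_1·Cov(G_0,G_2) + δ_2·Cov(G_0,G_1) + μ(G_0)·(μ(G_1G_2) − μ(H_1H_2))`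
(generalises the one-moving-slot face `δ_1 = δ_2 = 0` and the outside-removal sub-face `H_0 = G_0`). [this work] -/
theorem twoLevelTop_eq_of_outside₀ (q : κ → unitInterval) (G H : Fin 3 → Set (Set κ)) (hH0 : H 0 ⊆ G 0)
    (hH1 : H 1 ⊆ G 1) (hH2 : H 2 ⊆ G 2) (hout1 : G 0 ∩ G 1 ⊆ H 1) (hout2 : G 0 ∩ G 2 ⊆ H 2) :
    twoLevelForm (fun A => (prodBernoulli q).real A) G H
        - ∏ i, ((prodBernoulli q).real (G i) - (prodBernoulli q).real (H i)) =
      sahiE3 (prodBernoulli q) (G 0) (G 1) (G 2) + sahiE3 (prodBernoulli q) (H 0) (G 1) (G 2)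
      + ((prodBernoulli q).real (G 1) - (prodBernoulli q).real (H 1))
          * ((prodBernoulli q).real (G 0 ∩ G 2) - (prodBernoulli q).real (G 0) * (prodBernoulli q).real (G 2))
      + ((prodBernoulli q).real (G 2) - (prodBernoulli q).real (H 2))
          * ((prodBernoulli q).real (G 0 ∩ G 1) - (prodBernoulli q).real (G 0) * (prodBernoulli q).real (G 1))
      + (prodBernoulli q).real (G 0) * ((prodBernoulli q).real (G 1 ∩ G 2) - (prodBernoulli q).real (H 1 ∩ H 2)) := by
  have e3 : H 0 ∩ H 1 ∩ H 2 = H 0 ∩ G 1 ∩ G 2 := by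
    ext ω; simp only [Set.mem_inter_iff]
    exact ⟨fun ⟨⟨a, b⟩, c⟩ => ⟨⟨a, hH1 b⟩, hH2 c⟩, fun ⟨⟨a, b⟩, c⟩ => ⟨⟨a, hout1 ⟨hH0 a, b⟩⟩, hout2 ⟨hH0 a, c⟩⟩⟩
  have e1 : H 0 ∩ H 1 = H 0 ∩ G 1 := by
    ext ω; simp only [Set.mem_inter_iff]
    exact ⟨fun ⟨a, b⟩ => ⟨a, hH1 b⟩, fun ⟨a, b⟩ => ⟨a, hout1 ⟨hH0 a, b⟩⟩⟩
  have e2 : H 0 ∩ H 2 = H 0 ∩ G 2 := by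
    ext ω; simp only [Set.mem_inter_iff]
    exact ⟨fun ⟨a, b⟩ => ⟨a, hH2 b⟩, fun ⟨a, b⟩ => ⟨a, hout2 ⟨hH0 a, b⟩⟩⟩
  simp only [twoLevelForm, Fin.prod_univ_three, sahiE3_def]
  rw [e3, e1, e2]
  ring

/-- **`T⁺ ≥ E_3(G_0,G_1,G_2) + E_3(H_0,G_1,G_2)` when the removed parts of slots `1, 2` avoid `G_0`** (Harris for `(G_0,G_i)` and
monotonicity); hence `SahiTwoLevelPlus` there from `C_3` for two triples (`twoLevelTop_nonneg_of_outside₀`). [this work] -/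
theorem sahiE3_add_sahiE3_le_twoLevelTop_of_outside₀ (q : κ → unitInterval) (G H : Fin 3 → Set (Set κ))
    (hG : ∀ i, IsUpperSet (G i)) (hH0 : H 0 ⊆ G 0) (hH1 : H 1 ⊆ G 1) (hH2 : H 2 ⊆ G 2)
    (hout1 : G 0 ∩ G 1 ⊆ H 1) (hout2 : G 0 ∩ G 2 ⊆ H 2) :
    sahiE3 (prodBernoulli q) (G 0) (G 1) (G 2) + sahiE3 (prodBernoulli q) (H 0) (G 1) (G 2) ≤
      twoLevelForm (fun A => (prodBernoulli q).real A) G H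
        - ∏ i, ((prodBernoulli q).real (G i) - (prodBernoulli q).real (H i)) := by
  rw [twoLevelTop_eq_of_outside₀ q G H hH0 hH1 hH2 hout1 hout2]
  have hδ1 : 0 ≤ (prodBernoulli q).real (G 1) - (prodBernoulli q).real (H 1) := sub_nonneg.2 (measureReal_mono hH1)
  have hδ2 : 0 ≤ (prodBernoulli q).real (G 2) - (prodBernoulli q).real (H 2) := sub_nonneg.2 (measureReal_mono hH2)
  have hc1 : 0 ≤ (prodBernoulli q).real (G 0 ∩ G 1) - (prodBernoulli q).real (G 0) * (prodBernoulli q).real (G 1) :=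
    sub_nonneg.2 (prodBernoulli_harris q (hG 0) (hG 1) MeasurableSet.of_discrete MeasurableSet.of_discrete)
  have hc2 : 0 ≤ (prodBernoulli q).real (G 0 ∩ G 2) - (prodBernoulli q).real (G 0) * (prodBernoulli q).real (G 2) :=
    sub_nonneg.2 (prodBernoulli_harris q (hG 0) (hG 2) MeasurableSet.of_discrete MeasurableSet.of_discrete)
  have hm : 0 ≤ (prodBernoulli q).real (G 1 ∩ G 2) - (prodBernoulli q).real (H 1 ∩ H 2) :=
    sub_nonneg.2 (measureReal_mono (Set.inter_subset_inter hH1 hH2))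
  have hf : 0 ≤ (prodBernoulli q).real (G 0) := measureReal_nonneg
  nlinarith [mul_nonneg hδ1 hc2, mul_nonneg hδ2 hc1, mul_nonneg hf hm]

/-- **`SahiTwoLevelPlus` when the removed parts of slots `1, 2` avoid `G_0`, from `C_3`** for `(G_0,G_1,G_2)` and `(H_0,G_1,G_2)`. [this work] -/
theorem twoLevelTop_nonneg_of_outside₀ (q : κ → unitInterval) (G H : Fin 3 → Set (Set κ))
    (hG : ∀ i, IsUpperSet (G i)) (hH0 : H 0 ⊆ G 0) (hH1 : H 1 ⊆ G 1) (hH2 : H 2 ⊆ G 2)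
    (hout1 : G 0 ∩ G 1 ⊆ H 1) (hout2 : G 0 ∩ G 2 ⊆ H 2)
    (hE₃G : 0 ≤ sahiE3 (prodBernoulli q) (G 0) (G 1) (G 2)) (hE₃H : 0 ≤ sahiE3 (prodBernoulli q) (H 0) (G 1) (G 2)) :
    0 ≤ twoLevelForm (fun A => (prodBernoulli q).real A) G H
        - ∏ i, ((prodBernoulli q).real (G i) - (prodBernoulli q).real (H i)) :=
  le_trans (add_nonneg hE₃G hE₃H) (sahiE3_add_sahiE3_le_twoLevelTop_of_outside₀ q G H hG hH0 hH1 hH2 hout1 hout2)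

/-- The same from Kahn's Conjecture 5 (`H_0` increasing as well). [this work] -/
theorem twoLevelTop_nonneg_of_outside₀_of_kahn (hK : KahnConjecture) (q : κ → unitInterval) (G H : Fin 3 → Set (Set κ))
    (hG : ∀ i, IsUpperSet (G i)) (hH0u : IsUpperSet (H 0)) (hH0 : H 0 ⊆ G 0) (hH1 : H 1 ⊆ G 1) (hH2 : H 2 ⊆ G 2)
    (hout1 : G 0 ∩ G 1 ⊆ H 1) (hout2 : G 0 ∩ G 2 ⊆ H 2) :
    0 ≤ twoLevelForm (fun A => (prodBernoulli q).real A) G H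
        - ∏ i, ((prodBernoulli q).real (G i) - (prodBernoulli q).real (H i)) :=
  twoLevelTop_nonneg_of_outside₀ q G H hG hH0 hH1 hH2 hout1 hout2 (hK κ q _ _ _ (hG 0) (hG 1) (hG 2))
    (hK κ q _ _ _ hH0u (hG 1) (hG 2))

/-! ### One idle slot: the two exact forms -/

omit [Fintype κ] in
/-- **One idle slot, expansion around the top** (`F := G_0 = H_0`): with `δ_i = μ(G_i) − μ(H_i)` and `μ(F ∩ D_i) = μ(F ∩ G_i) − μ(F ∩ H_i)`,
`T⁺ = E_3(F,G_1,G_2) + E_3(F,H_1,H_2) + δ_2 μ(F ∩ D_1) + δ_1 μ(F ∩ D_2) − μ(F) δ_1 δ_2` (ring identity in the moments). [this work] -/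
theorem twoLevelTop_eq_of_idle₀ (q : κ → unitInterval) (G H : Fin 3 → Set (Set κ)) (h0 : H 0 = G 0) :
    twoLevelForm (fun A => (prodBernoulli q).real A) G H
        - ∏ i, ((prodBernoulli q).real (G i) - (prodBernoulli q).real (H i)) =
      sahiE3 (prodBernoulli q) (G 0) (G 1) (G 2) + sahiE3 (prodBernoulli q) (G 0) (H 1) (H 2)
      + ((prodBernoulli q).real (G 2) - (prodBernoulli q).real (H 2))
          * ((prodBernoulli q).real (G 0 ∩ G 1) - (prodBernoulli q).real (G 0 ∩ H 1))
      + ((prodBernoulli q).real (G 1) - (prodBernoulli q).real (H 1))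
          * ((prodBernoulli q).real (G 0 ∩ G 2) - (prodBernoulli q).real (G 0 ∩ H 2))
      - (prodBernoulli q).real (G 0) * ((prodBernoulli q).real (G 1) - (prodBernoulli q).real (H 1))
          * ((prodBernoulli q).real (G 2) - (prodBernoulli q).real (H 2)) := by
  simp only [twoLevelForm, Fin.prod_univ_three, sahiE3_def, h0]
  ring

omit [Fintype κ] in
/-- **One idle slot, bilinear form** (`F := G_0 = H_0`): `T⁺ = E_3(F,H_1,G_2) + E_3(F,G_1,H_2) + 2·ι₃ − μ(F)·ι₂` with
`ι₃ = μ(FG_1G_2) − μ(FH_1G_2) − μ(FG_1H_2) + μ(FH_1H_2)` (`= μ(F ∩ D_1 ∩ D_2)` for a nested pair) and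
`ι₂ = μ(G_1G_2) − μ(H_1G_2) − μ(G_1H_2) + μ(H_1H_2)` (`= μ(D_1 ∩ D_2)`).  Ring identity; = prim-ineq-gen-4 g13 (F) at measure level. [this work] -/
theorem twoLevelTop_eq_of_idle₀' (q : κ → unitInterval) (G H : Fin 3 → Set (Set κ)) (h0 : H 0 = G 0) :
    twoLevelForm (fun A => (prodBernoulli q).real A) G H
        - ∏ i, ((prodBernoulli q).real (G i) - (prodBernoulli q).real (H i)) =
      sahiE3 (prodBernoulli q) (G 0) (H 1) (G 2) + sahiE3 (prodBernoulli q) (G 0) (G 1) (H 2)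
      + 2 * ((prodBernoulli q).real (G 0 ∩ G 1 ∩ G 2) - (prodBernoulli q).real (G 0 ∩ H 1 ∩ G 2)
              - (prodBernoulli q).real (G 0 ∩ G 1 ∩ H 2) + (prodBernoulli q).real (G 0 ∩ H 1 ∩ H 2))
      - (prodBernoulli q).real (G 0) * ((prodBernoulli q).real (G 1 ∩ G 2) - (prodBernoulli q).real (H 1 ∩ G 2)
              - (prodBernoulli q).real (G 1 ∩ H 2) + (prodBernoulli q).real (H 1 ∩ H 2)) := by
  simp only [twoLevelForm, Fin.prod_univ_three, sahiE3_def, h0]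
  ring

/-! ### The inside-meeting sub-face: `D_1 ∩ D_2 ⊆ F` -/

omit [Fintype κ] in
/-- Pointwise: for indicators `f, g₁ ≥ h₁, g₂ ≥ h₂` with `(g₁ − h₁)(g₂ − h₂) ≤ f` (i.e. `D_1 ∩ D_2 ⊆ F`) and `c ≤ 1`,
`0 ≤ 2·f(g₁−h₁)(g₂−h₂) − c·(g₁−h₁)(g₂−h₂)`. [folklore] -/
theorem inside_pointwise (F G₁ H₁ G₂ H₂ : Set (Set κ)) (hH1 : H₁ ⊆ G₁) (hH2 : H₂ ⊆ G₂) (hin : (G₁ \ H₁) ∩ (G₂ \ H₂) ⊆ F)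
    {c : ℝ} (hc1 : c ≤ 1) (ω : Set κ) :
    0 ≤ 2 * (ind F ω * ((ind G₁ ω - ind H₁ ω) * (ind G₂ ω - ind H₂ ω)))
        - c * ((ind G₁ ω - ind H₁ ω) * (ind G₂ ω - ind H₂ ω)) := by
  by_cases hg1 : ω ∈ G₁ <;> by_cases hh1 : ω ∈ H₁ <;> by_cases hg2 : ω ∈ G₂ <;> by_cases hh2 : ω ∈ H₂ <;>
    by_cases hf : ω ∈ F <;>
    first
    | (exfalso; exact hg1 (hH1 hh1))
    | (exfalso; exact hg2 (hH2 hh2))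
    | (exfalso; exact hf (hin ⟨⟨hg1, hh1⟩, ⟨hg2, hh2⟩⟩))
    | (norm_num [ind_of_mem, ind_of_not_mem, hg1, hh1, hg2, hh2, hf]; try nlinarith)

/-- **Inside-meeting sub-face**: if `H_0 = G_0 =: F`, `H_i ⊆ G_i` and `D_1 ∩ D_2 ⊆ F` then
`T⁺ ≥ E_3(F,H_1,G_2) + E_3(F,G_1,H_2)`. [this work] -/
theorem sahiE3_add_sahiE3_le_twoLevelTop_of_idle₀_inside (q : κ → unitInterval) (G H : Fin 3 → Set (Set κ)) (h0 : H 0 = G 0)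
    (hH1 : H 1 ⊆ G 1) (hH2 : H 2 ⊆ G 2) (hin : (G 1 \ H 1) ∩ (G 2 \ H 2) ⊆ G 0) :
    sahiE3 (prodBernoulli q) (G 0) (H 1) (G 2) + sahiE3 (prodBernoulli q) (G 0) (G 1) (H 2) ≤
      twoLevelForm (fun A => (prodBernoulli q).real A) G H
        - ∏ i, ((prodBernoulli q).real (G i) - (prodBernoulli q).real (H i)) := by
  rw [twoLevelTop_eq_of_idle₀' q G H h0]
  have hc1 : (prodBernoulli q).real (G 0) ≤ 1 := measureReal_le_one
  -- everything as expectations under the product weight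
  have key : 0 ≤ 2 * ((prodBernoulli q).real (G 0 ∩ G 1 ∩ G 2) - (prodBernoulli q).real (G 0 ∩ H 1 ∩ G 2)
              - (prodBernoulli q).real (G 0 ∩ G 1 ∩ H 2) + (prodBernoulli q).real (G 0 ∩ H 1 ∩ H 2))
      - (prodBernoulli q).real (G 0) * ((prodBernoulli q).real (G 1 ∩ G 2) - (prodBernoulli q).real (H 1 ∩ G 2)
              - (prodBernoulli q).real (G 1 ∩ H 2) + (prodBernoulli q).real (H 1 ∩ H 2)) := by
    set c := (prodBernoulli q).real (G 0) with hc
    simp only [← ex_bernoulliWeight_ind]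
    have hsum : 2 * (ex (bernoulliWeight q) (ind (G 0 ∩ G 1 ∩ G 2)) - ex (bernoulliWeight q) (ind (G 0 ∩ H 1 ∩ G 2))
              - ex (bernoulliWeight q) (ind (G 0 ∩ G 1 ∩ H 2)) + ex (bernoulliWeight q) (ind (G 0 ∩ H 1 ∩ H 2)))
        - c * (ex (bernoulliWeight q) (ind (G 1 ∩ G 2)) - ex (bernoulliWeight q) (ind (H 1 ∩ G 2))
              - ex (bernoulliWeight q) (ind (G 1 ∩ H 2)) + ex (bernoulliWeight q) (ind (H 1 ∩ H 2))) =
        ex (bernoulliWeight q) (fun ω => 2 * (ind (G 0) ω * ((ind (G 1) ω - ind (H 1) ω) * (ind (G 2) ω - ind (H 2) ω)))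
          - c * ((ind (G 1) ω - ind (H 1) ω) * (ind (G 2) ω - ind (H 2) ω))) := by
      simp only [ex, ← Finset.sum_sub_distrib, ← Finset.sum_add_distrib, Finset.mul_sum, ind_inter_mul]
      exact Finset.sum_congr rfl fun ω _ => by ring
    rw [hsum]
    exact ex_nonneg (isFKGMeasure_bernoulliWeight q).nonneg fun ω =>
      inside_pointwise (G 0) (G 1) (H 1) (G 2) (H 2) hH1 hH2 hin hc1 ω
  linarith

/-- **`SahiTwoLevelPlus` on the inside-meeting sub-face from `C_3`** for `(F,H_1,G_2)` and `(F,G_1,H_2)`. [this work] -/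
theorem twoLevelTop_nonneg_of_idle₀_inside (q : κ → unitInterval) (G H : Fin 3 → Set (Set κ)) (h0 : H 0 = G 0)
    (hH1 : H 1 ⊆ G 1) (hH2 : H 2 ⊆ G 2) (hin : (G 1 \ H 1) ∩ (G 2 \ H 2) ⊆ G 0)
    (hE₃a : 0 ≤ sahiE3 (prodBernoulli q) (G 0) (H 1) (G 2)) (hE₃b : 0 ≤ sahiE3 (prodBernoulli q) (G 0) (G 1) (H 2)) :
    0 ≤ twoLevelForm (fun A => (prodBernoulli q).real A) G H
        - ∏ i, ((prodBernoulli q).real (G i) - (prodBernoulli q).real (H i)) :=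
  le_trans (add_nonneg hE₃a hE₃b) (sahiE3_add_sahiE3_le_twoLevelTop_of_idle₀_inside q G H h0 hH1 hH2 hin)

/-! ### The outside-removal sub-face: `G_i ∩ F ⊆ H_i` -/

omit [Fintype κ] in
/-- **Outside-removal sub-face, exact form**: if `H_0 = G_0 =: F`, `H_i ⊆ G_i` and `G_i ∩ F ⊆ H_i` (`i = 1,2`) then
`T⁺ = 2E_3(F,G_1,G_2) + δ_2·Cov(F,G_1) + δ_1·Cov(F,G_2) + μ(F)·(μ(G_1G_2) − μ(H_1H_2))`. [this work] -/
theorem twoLevelTop_eq_of_idle₀_outside (q : κ → unitInterval) (G H : Fin 3 → Set (Set κ)) (h0 : H 0 = G 0)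
    (hH1 : H 1 ⊆ G 1) (hH2 : H 2 ⊆ G 2) (hout1 : G 0 ∩ G 1 ⊆ H 1) (hout2 : G 0 ∩ G 2 ⊆ H 2) :
    twoLevelForm (fun A => (prodBernoulli q).real A) G H
        - ∏ i, ((prodBernoulli q).real (G i) - (prodBernoulli q).real (H i)) =
      2 * sahiE3 (prodBernoulli q) (G 0) (G 1) (G 2)
      + ((prodBernoulli q).real (G 2) - (prodBernoulli q).real (H 2))
          * ((prodBernoulli q).real (G 0 ∩ G 1) - (prodBernoulli q).real (G 0) * (prodBernoulli q).real (G 1))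
      + ((prodBernoulli q).real (G 1) - (prodBernoulli q).real (H 1))
          * ((prodBernoulli q).real (G 0 ∩ G 2) - (prodBernoulli q).real (G 0) * (prodBernoulli q).real (G 2))
      + (prodBernoulli q).real (G 0) * ((prodBernoulli q).real (G 1 ∩ G 2) - (prodBernoulli q).real (H 1 ∩ H 2)) := by
  have e3 : G 0 ∩ H 1 ∩ H 2 = G 0 ∩ G 1 ∩ G 2 := by
    ext ω; simp only [Set.mem_inter_iff]
    exact ⟨fun ⟨⟨a, b⟩, c⟩ => ⟨⟨a, hH1 b⟩, hH2 c⟩, fun ⟨⟨a, b⟩, c⟩ => ⟨⟨a, hout1 ⟨a, b⟩⟩, hout2 ⟨a, c⟩⟩⟩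
  have e1 : G 0 ∩ H 1 = G 0 ∩ G 1 := by
    ext ω; simp only [Set.mem_inter_iff]
    exact ⟨fun ⟨a, b⟩ => ⟨a, hH1 b⟩, fun ⟨a, b⟩ => ⟨a, hout1 ⟨a, b⟩⟩⟩
  have e2 : G 0 ∩ H 2 = G 0 ∩ G 2 := by
    ext ω; simp only [Set.mem_inter_iff]
    exact ⟨fun ⟨a, b⟩ => ⟨a, hH2 b⟩, fun ⟨a, b⟩ => ⟨a, hout2 ⟨a, b⟩⟩⟩
  rw [twoLevelTop_eq_of_idle₀ q G H h0, sahiE3_def, sahiE3_def, e3, e1, e2]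
  ring

/-- **THEOREM (outside-removal sub-face): `T⁺ ≥ 2·E_3(F,G_1,G_2)`** for a product measure, `F, G_1, G_2` increasing, `H_i ⊆ G_i` with
`G_i ∩ F ⊆ H_i` (Harris for `(F,G_i)` and monotonicity).  Measure-level shadow of the coefficientwise `c_2 ≥ 3c_3` on this sub-face. [this work] -/
theorem two_mul_sahiE3_le_twoLevelTop_of_idle₀_outside (q : κ → unitInterval) (G H : Fin 3 → Set (Set κ)) (h0 : H 0 = G 0)
    (hG : ∀ i, IsUpperSet (G i)) (hH1 : H 1 ⊆ G 1) (hH2 : H 2 ⊆ G 2) (hout1 : G 0 ∩ G 1 ⊆ H 1) (hout2 : G 0 ∩ G 2 ⊆ H 2) :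
    2 * sahiE3 (prodBernoulli q) (G 0) (G 1) (G 2) ≤
      twoLevelForm (fun A => (prodBernoulli q).real A) G H
        - ∏ i, ((prodBernoulli q).real (G i) - (prodBernoulli q).real (H i)) := by
  rw [twoLevelTop_eq_of_idle₀_outside q G H h0 hH1 hH2 hout1 hout2]
  have hδ1 : 0 ≤ (prodBernoulli q).real (G 1) - (prodBernoulli q).real (H 1) := sub_nonneg.2 (measureReal_mono hH1)
  have hδ2 : 0 ≤ (prodBernoulli q).real (G 2) - (prodBernoulli q).real (H 2) := sub_nonneg.2 (measureReal_mono hH2)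
  have hc1 : 0 ≤ (prodBernoulli q).real (G 0 ∩ G 1) - (prodBernoulli q).real (G 0) * (prodBernoulli q).real (G 1) :=
    sub_nonneg.2 (prodBernoulli_harris q (hG 0) (hG 1) MeasurableSet.of_discrete MeasurableSet.of_discrete)
  have hc2 : 0 ≤ (prodBernoulli q).real (G 0 ∩ G 2) - (prodBernoulli q).real (G 0) * (prodBernoulli q).real (G 2) :=
    sub_nonneg.2 (prodBernoulli_harris q (hG 0) (hG 2) MeasurableSet.of_discrete MeasurableSet.of_discrete)
  have hm : 0 ≤ (prodBernoulli q).real (G 1 ∩ G 2) - (prodBernoulli q).real (H 1 ∩ H 2) :=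
    sub_nonneg.2 (measureReal_mono (Set.inter_subset_inter hH1 hH2))
  have hf : 0 ≤ (prodBernoulli q).real (G 0) := measureReal_nonneg
  nlinarith [mul_nonneg hδ2 hc1, mul_nonneg hδ1 hc2, mul_nonneg hf hm]

/-- **`SahiTwoLevelPlus` on the outside-removal sub-face from `C_3` for the single triple `(F,G_1,G_2)`.** [this work] -/
theorem twoLevelTop_nonneg_of_idle₀_outside (q : κ → unitInterval) (G H : Fin 3 → Set (Set κ)) (h0 : H 0 = G 0)
    (hG : ∀ i, IsUpperSet (G i)) (hH1 : H 1 ⊆ G 1) (hH2 : H 2 ⊆ G 2) (hout1 : G 0 ∩ G 1 ⊆ H 1) (hout2 : G 0 ∩ G 2 ⊆ H 2)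
    (hE₃ : 0 ≤ sahiE3 (prodBernoulli q) (G 0) (G 1) (G 2)) :
    0 ≤ twoLevelForm (fun A => (prodBernoulli q).real A) G H
        - ∏ i, ((prodBernoulli q).real (G i) - (prodBernoulli q).real (H i)) :=
  le_trans (by linarith) (two_mul_sahiE3_le_twoLevelTop_of_idle₀_outside q G H h0 hG hH1 hH2 hout1 hout2)

/-- The same from Kahn's Conjecture 5. [this work] -/
theorem twoLevelTop_nonneg_of_idle₀_outside_of_kahn (hK : KahnConjecture) (q : κ → unitInterval) (G H : Fin 3 → Set (Set κ))
    (h0 : H 0 = G 0) (hG : ∀ i, IsUpperSet (G i)) (hH1 : H 1 ⊆ G 1) (hH2 : H 2 ⊆ G 2)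
    (hout1 : G 0 ∩ G 1 ⊆ H 1) (hout2 : G 0 ∩ G 2 ⊆ H 2) :
    0 ≤ twoLevelForm (fun A => (prodBernoulli q).real A) G H
        - ∏ i, ((prodBernoulli q).real (G i) - (prodBernoulli q).real (H i)) :=
  twoLevelTop_nonneg_of_idle₀_outside q G H h0 hG hH1 hH2 hout1 hout2 (hK κ q _ _ _ (hG 0) (hG 1) (hG 2))

omit [Fintype κ] in
/-- **The canonical bottom `H_i = G_i ∩ F`** (a point of the outside-removal sub-face): unconditionally
`T⁺ = 2E_3(F,G_1,G_2) + μ(G_2 ∖ F)·Cov(F,G_1) + μ(G_1 ∖ F)·Cov(F,G_2) + μ(F)·μ(G_1G_2 ∖ F)` written in moments. [this work] -/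
theorem twoLevelTop_eq_of_idle₀_interF (q : κ → unitInterval) (F G₁ G₂ : Set (Set κ)) (G H : Fin 3 → Set (Set κ))
    (hG0 : G 0 = F) (hG1 : G 1 = G₁) (hG2 : G 2 = G₂) (hH0 : H 0 = F) (hH1 : H 1 = G₁ ∩ F) (hH2 : H 2 = G₂ ∩ F) :
    twoLevelForm (fun A => (prodBernoulli q).real A) G H
        - ∏ i, ((prodBernoulli q).real (G i) - (prodBernoulli q).real (H i)) =
      2 * sahiE3 (prodBernoulli q) F G₁ G₂
      + ((prodBernoulli q).real G₂ - (prodBernoulli q).real (F ∩ G₂))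
          * ((prodBernoulli q).real (F ∩ G₁) - (prodBernoulli q).real F * (prodBernoulli q).real G₁)
      + ((prodBernoulli q).real G₁ - (prodBernoulli q).real (F ∩ G₁))
          * ((prodBernoulli q).real (F ∩ G₂) - (prodBernoulli q).real F * (prodBernoulli q).real G₂)
      + (prodBernoulli q).real F * ((prodBernoulli q).real (G₁ ∩ G₂) - (prodBernoulli q).real (F ∩ G₁ ∩ G₂)) := by
  subst hG0 hG1 hG2
  have h0 : H 0 = G 0 := hH0
  have hsub1 : H 1 ⊆ G 1 := by rw [hH1]; exact Set.inter_subset_left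
  have hsub2 : H 2 ⊆ G 2 := by rw [hH2]; exact Set.inter_subset_left
  have hout1 : G 0 ∩ G 1 ⊆ H 1 := by rw [hH1]; exact fun ω h => ⟨h.2, h.1⟩
  have hout2 : G 0 ∩ G 2 ⊆ H 2 := by rw [hH2]; exact fun ω h => ⟨h.2, h.1⟩
  rw [twoLevelTop_eq_of_idle₀_outside q G H h0 hsub1 hsub2 hout1 hout2]
  have e1 : (prodBernoulli q).real (H 1) = (prodBernoulli q).real (G 0 ∩ G 1) := by rw [hH1, Set.inter_comm]
  have e2 : (prodBernoulli q).real (H 2) = (prodBernoulli q).real (G 0 ∩ G 2) := by rw [hH2, Set.inter_comm]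
  have e12 : (prodBernoulli q).real (H 1 ∩ H 2) = (prodBernoulli q).real (G 0 ∩ G 1 ∩ G 2) := by
    rw [hH1, hH2]; congr 1; ext ω; simp only [Set.mem_inter_iff]; tauto
  rw [e1, e2, e12]

end SahiTwoLevelIdle

end Summit.CriticalPhenomena.PercolationContinuityZ3.Theorems
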